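import Literature.NumberTheory.Automorphic.RationalPointsConeConjugates
import Literature.NumberTheory.Automorphic.AdelicGroupDataGLnProofs
import HarnessLib

/-!
# Bounded multiplicity of rational points in cone conjugates, modulo rational unipotents
(Godement, *Domaines fondamentaux des groupes arithmétiques*, Sém. Bourbaki 257 (1962/63), §10,
Théorème 9 (Borel's "Siegel property") and Lemmes 1–4; Garrett, *Modern Analysis of Automorphic
Forms by Example* (2018), proof of Thm. 7.3.10, PDF p. 342; Getz–Hahn, *An Introduction to
Automorphic Representations* (2024), (9.22)–(9.23), printed p. 190)

A brick of the basic estimate for cusp forms on a Siegel set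
(`GLnCuspidalSpectrum.norm_smoothedForm_le_of_isSiegelSetGL`, Garrett Thm. 7.3.10 / Getz–Hahn
Prop. 9.6.1). The last step of the printed proofs compares an integral of `|φ|` (`|φ|²`) over the
`N(K)`-wound region `N(K)\N(K) y Ω` with `‖φ‖_{L²(GL_n(K) A_G \ GL_n(𝔸_K))}` (Garrett, PDF p. 342:
"`∫_{Z⁺G_k\G_k𝔖} |f(x)| dx ≤ … |f|_{L²}`"; Getz–Hahn (9.23): "`(∫_{Ω_N s_x Ω_G} |φ(y)|² dy)^{1/2}
≪ ‖φ‖₂`"), which requires that the fibres of `N(K)\N(K) y Ω → GL_n(K)\GL_n(𝔸_K)` have boundedly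
many points, uniformly in the position `y = s` on the Siegel cone; neither source spells this out.
The tree vendors the classical input for this step as a NAMED FACT: Borel's Siegel property
`siegelFiniteness_gl n K` of `ReductionTheoryGLnSiegelProperty` (Godement, Théorème 9: a Siegel
set meets only finitely many of its rational translates), with the proved corollary
`siegelFiniteness_gl.exists_ncard_le` ("the form consumed by the basic estimate"). This file
proves, WITHOUT any named fact, the companion statement in the `N(K)`-wound form — a bound on the
number of cosets of the rational unipotent group met by the rational points of `s Ω s⁻¹`, uniform
in the cone position `s` — which can replace (or sit beside) the `siegelFiniteness_gl` route in the
proof of `norm_smoothedForm_le_of_isSiegelSetGL`; for `G = GL_n` over a number field: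

* `exists_forall_siegelCone_subset_unipotent_mul` — **for every compact `Ω ⊆ GL_n(𝔸_K)` and
  `t > 0` there is `m₀` such that for every `a` in the Siegel cone (`t a_{l+1} ≤ a_l`), with
  `s = diag(a)` (`posRealDiagonal`), the rational points of `s Ω s⁻¹` lie in at most `m₀` cosets
  of the rational upper unitriangular group**:
  `GL_n(K) ∩ s Ω s⁻¹ ⊆ (GL_n(K) ∩ N(𝔸_K)) · F`, `F ⊆ GL_n(K)` finite with `#F ≤ m₀`.

Proof (Godement's Lemmes 1–3 specialised to `GL_n`, made effective): let `ε = ε(Ω ∪ Ω⁻¹)` be the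
constant of the contraction lemma (`RationalPointsConeConjugates`: entries of rational points of
`s Ω s⁻¹` vanish where `a_i/a_j ≤ ε`). Group the indices into the blocks separated by the *large*
gaps `a_l / a_{l+1} > M`, `M = (ε tⁿ)⁻¹` (`gapLabel`, a monotone block labelling); across blocks the
torus contracts by `≤ ε`, so every rational `γ ∈ s Ω s⁻¹` lies in the standard parabolic
`P_c(K)` of this labelling (`exists_pos_forall_mem_standardParabolicGL_of_map_eq_conj`), while
inside a block all quotients `a_i/a_j` are bounded by `R = max(M, t⁻¹)ⁿ`, so the block-diagonal part
`λ(γ) ∈ GL_n(K)` of `γ` lies in a compact subset of `GL_n(𝔸_K)` depending only on `(Ω, t)`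
(entries `(a_i/a_j, 1) · ω_{ij}` on the blocks, likewise for `γ⁻¹ ∈ s Ω⁻¹ s⁻¹`), hence in a
fixed finite set (`GL_n(K)` is discrete and closed in `GL_n(𝔸_K)`, `gl_isDiscreteRational_holds`);
and two elements of `P_c(K)` with the same block-diagonal part differ by an element of the
unipotent radical `U_c(K) ≤ N(K)`.

Also proved on the way (all `[folklore]`): the combinatorics of `gapLabel` (monotone; a large gap
separates different labels; none separates equal labels) and the resulting quotient bounds on the
cone; `coe_leviEmbedding_leviProjection_apply` (entries of the block-diagonal part);
`unipotentRadicalGL_le_upperUnitriangular` (for a monotone labelling); the scaling maps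
`leviBlockScale` and the compatibility of `GeneralLinearGroup.map` with `upperUnitriangular`.

## References

* R. Godement, *Domaines fondamentaux des groupes arithmétiques*, Sém. Bourbaki 257 (1962/63),
  §10, Théorème 9 and Lemmes 1–4 (English translation in Borel–Godement–Siegel–Weil (2020), PDF
  pp. 170–172 of the held copy) [Godement1964].
* P. Garrett, *Modern Analysis of Automorphic Forms by Example* (2018), Thm. 7.3.10, end of proof
  (PDF p. 342) [Garrett2018].
* J. R. Getz, H. Hahn, *An Introduction to Automorphic Representations*, GTM 300 (2024),
  (9.22)–(9.23) (printed p. 190) [GetzHahn2024].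
-/

noncomputable section

open scoped NNReal MatrixGroups Pointwise Topology Classical
open NumberField IsDedekindDomain Set Filter

namespace Literature.NumberTheory.Automorphic

/-! ### The block labelling by large gaps -/

section Gaps

variable {n : ℕ}

/-- `a` has a **large gap at `l`** (threshold `M`): `l + 1 < n` and `a_l > M · a_{l+1}`.
[folklore] -/
def LargeGap (a : Fin n → ℝ≥0ˣ) (M : ℝ) (l : Fin n) : Prop :=
  ∃ h : (l : ℕ) + 1 < n, M * ((a ⟨(l : ℕ) + 1, h⟩ : ℝ≥0) : ℝ) < ((a l : ℝ≥0) : ℝ)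

/-- The number of large gaps strictly before the index `i`. [folklore] -/
def gapCount (a : Fin n → ℝ≥0ˣ) (M : ℝ) (i : Fin n) : ℕ :=
  ((Finset.univ : Finset (Fin n)).filter fun l : Fin n => l.val < i.val ∧ LargeGap a M l).card

/-- There are at most `n` large gaps before any index. [folklore] -/
theorem gapCount_le (a : Fin n → ℝ≥0ˣ) (M : ℝ) (i : Fin n) : gapCount a M i ≤ n := by
  unfold gapCount
  refine (Finset.card_filter_le _ _).trans ?_
  rw [Finset.card_univ, Fintype.card_fin]

/-- **The block labelling by large gaps**: `i ↦ #{large gaps before i} ∈ Fin (n+1)`; indices in the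
same block are those not separated by a large gap. [folklore] -/
def gapLabel (a : Fin n → ℝ≥0ˣ) (M : ℝ) (i : Fin n) : Fin (n + 1) :=
  ⟨gapCount a M i, Nat.lt_succ_of_le (gapCount_le a M i)⟩

/-- The value of the label is the gap count. [folklore] -/
theorem gapLabel_val (a : Fin n → ℝ≥0ˣ) (M : ℝ) (i : Fin n) :
    ((gapLabel a M i : Fin (n + 1)) : ℕ) = gapCount a M i := rfl

/-- The labelling is monotone. [folklore] -/
theorem monotone_gapLabel (a : Fin n → ℝ≥0ˣ) (M : ℝ) : Monotone (gapLabel a M) := by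
  intro i j hij
  rw [Fin.le_def, gapLabel_val, gapLabel_val]
  unfold gapCount
  refine Finset.card_le_card fun l hl => ?_
  simp only [Finset.mem_filter, Finset.mem_univ, true_and] at hl ⊢
  exact ⟨lt_of_lt_of_le hl.1 (Fin.le_def.1 hij), hl.2⟩

/-- **Different labels are separated by a large gap**: if `gapLabel j < gapLabel i` then `j < i`
and there is a large gap at some `l` with `j ≤ l < i`. [folklore] -/
theorem exists_largeGap_of_gapLabel_lt (a : Fin n → ℝ≥0ˣ) (M : ℝ) {i j : Fin n}
    (h : gapLabel a M j < gapLabel a M i) :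
    ∃ l : Fin n, (j : ℕ) ≤ (l : ℕ) ∧ (l : ℕ) < (i : ℕ) ∧ LargeGap a M l := by
  rw [Fin.lt_def, gapLabel_val, gapLabel_val] at h
  unfold gapCount at h
  by_contra hne
  push Not at hne
  apply not_le.2 h
  refine Finset.card_le_card fun l hl => ?_
  simp only [Finset.mem_filter, Finset.mem_univ, true_and] at hl ⊢
  refine ⟨?_, hl.2⟩
  by_contra hjl
  exact hne l (not_lt.1 hjl) hl.1 hl.2

/-- **Equal labels are not separated by a large gap**: if `gapLabel i = gapLabel j` and `i ≤ l < j`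
then the gap at `l` is not large. [folklore] -/
theorem not_largeGap_of_gapLabel_eq (a : Fin n → ℝ≥0ˣ) (M : ℝ) {i j l : Fin n}
    (h : gapLabel a M i = gapLabel a M j) (hil : (i : ℕ) ≤ (l : ℕ)) (hlj : (l : ℕ) < (j : ℕ)) :
    ¬ LargeGap a M l := by
  intro hl
  have hlt : gapCount a M i < gapCount a M j := by
    unfold gapCount
    refine Finset.card_lt_card ⟨fun l' hl' => ?_, ?_⟩
    · simp only [Finset.mem_filter, Finset.mem_univ, true_and] at hl' ⊢
      exact ⟨hl'.1.trans_le (hil.trans hlj.le), hl'.2⟩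
    · intro hsub
      have hmem : l ∈ (Finset.univ : Finset (Fin n)).filter
          fun l' : Fin n => l'.val < j.val ∧ LargeGap a M l' := by
        simp only [Finset.mem_filter, Finset.mem_univ, true_and]
        exact ⟨hlj, hl⟩
      have := hsub hmem
      simp only [Finset.mem_filter, Finset.mem_univ, true_and] at this
      exact absurd this.1 (not_lt.2 hil)
  have heq : gapCount a M i = gapCount a M j := by
    have := congrArg (fun x : Fin (n + 1) => (x : ℕ)) h
    exact this
  exact absurd heq hlt.ne

/-! ### Quotient bounds on the cone -/

/-- Inside a block, going up: if `i ≤ j` and no gap between `i` and `j` is large, then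
`a_i ≤ M^{j-i} a_j` (for `M ≥ 0`). [folklore] -/
theorem apply_le_pow_mul_of_forall_not_largeGap {M : ℝ} (hM : 0 ≤ M) (a : Fin n → ℝ≥0ˣ)
    {i j : Fin n} (hij : (i : ℕ) ≤ (j : ℕ))
    (h : ∀ l : Fin n, (i : ℕ) ≤ (l : ℕ) → (l : ℕ) < (j : ℕ) → ¬ LargeGap a M l) :
    ((a i : ℝ≥0) : ℝ) ≤ M ^ ((j : ℕ) - (i : ℕ)) * ((a j : ℝ≥0) : ℝ) := by
  suffices hk : ∀ k : ℕ, ∀ j : Fin n, (j : ℕ) = (i : ℕ) + k →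
      (∀ l : Fin n, (i : ℕ) ≤ (l : ℕ) → (l : ℕ) < (j : ℕ) → ¬ LargeGap a M l) →
      ((a i : ℝ≥0) : ℝ) ≤ M ^ k * ((a j : ℝ≥0) : ℝ) by
    have := hk ((j : ℕ) - (i : ℕ)) j (by omega) h
    exact this
  intro k
  induction k with
  | zero =>
    intro j hj _
    have : j = i := Fin.ext (by omega)
    subst this
    simp
  | succ k ih =>
    intro j hj hgap
    have hln : (i : ℕ) + k < n := by have := j.2; omega
    set l : Fin n := ⟨(i : ℕ) + k, hln⟩ with hl
    have hl1 : (l : ℕ) + 1 < n + 1 := by have := j.2; simp [hl]; omega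
    have hih : ((a i : ℝ≥0) : ℝ) ≤ M ^ k * ((a l : ℝ≥0) : ℝ) :=
      ih l rfl fun l' h1 h2 => hgap l' h1 (by simp [hl] at h2; omega)
    -- the gap at `l` is not large: `a_l ≤ M a_{l+1} = M a_j`
    have hnl : ¬ LargeGap a M l := hgap l (by simp [hl]) (by simp [hl]; omega)
    have hjl : j = ⟨(l : ℕ) + 1, by simp [hl]; omega⟩ := Fin.ext (by simp [hl]; omega)
    have hle : ((a l : ℝ≥0) : ℝ) ≤ M * ((a j : ℝ≥0) : ℝ) := by
      by_contra hlt
      exact hnl ⟨by simp [hl]; omega, by rw [hjl] at hlt; exact not_le.1 hlt⟩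
    calc ((a i : ℝ≥0) : ℝ) ≤ M ^ k * ((a l : ℝ≥0) : ℝ) := hih
      _ ≤ M ^ k * (M * ((a j : ℝ≥0) : ℝ)) := mul_le_mul_of_nonneg_left hle (pow_nonneg hM _)
      _ = M ^ (k + 1) * ((a j : ℝ≥0) : ℝ) := by ring

/-- **Across a large gap the torus contracts**: on the cone `t a_{l+1} ≤ a_l` (`0 < t ≤ 1`), if
there is a large gap (threshold `M > 0`) at some `l` with `j ≤ l < i`, then
`a_i ≤ M⁻¹ (t⁻¹)ⁿ a_j`. [folklore] -/
theorem apply_le_of_largeGap {t M : ℝ} (ht : 0 < t) (ht1 : t ≤ 1) (hM : 0 < M)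
    {a : Fin n → ℝ≥0ˣ}
    (hroot : ∀ i j : Fin n, (j : ℕ) = (i : ℕ) + 1 → t * ((a j : ℝ≥0) : ℝ) ≤ ((a i : ℝ≥0) : ℝ))
    {i j l : Fin n} (hjl : (j : ℕ) ≤ (l : ℕ)) (hli : (l : ℕ) < (i : ℕ)) (hl : LargeGap a M l) :
    ((a i : ℝ≥0) : ℝ) ≤ M⁻¹ * (t⁻¹ ^ n) * ((a j : ℝ≥0) : ℝ) := by
  obtain ⟨hl1, hgap⟩ := hl
  set l1 : Fin n := ⟨(l : ℕ) + 1, hl1⟩ with hl1def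
  have hti : 1 ≤ t⁻¹ := one_le_inv_iff₀.2 ⟨ht, ht1⟩
  -- `a_i ≤ t^{-(i-l-1)} a_{l+1}`
  have h1 : ((a i : ℝ≥0) : ℝ) ≤ t⁻¹ ^ ((i : ℕ) - (l1 : ℕ)) * ((a l1 : ℝ≥0) : ℝ) :=
    siegelRoot_apply_le_inv_pow_mul ht hroot (Fin.le_def.2 (by simp [hl1def]; omega))
  -- `a_{l+1} < a_l / M`
  have h2 : ((a l1 : ℝ≥0) : ℝ) ≤ M⁻¹ * ((a l : ℝ≥0) : ℝ) := by
    rw [inv_mul_eq_div, le_div_iff₀ hM, mul_comm]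
    exact hgap.le
  -- `a_l ≤ t^{-(l-j)} a_j`
  have h3 : ((a l : ℝ≥0) : ℝ) ≤ t⁻¹ ^ ((l : ℕ) - (j : ℕ)) * ((a j : ℝ≥0) : ℝ) :=
    siegelRoot_apply_le_inv_pow_mul ht hroot (Fin.le_def.2 hjl)
  have haj : 0 ≤ ((a j : ℝ≥0) : ℝ) := NNReal.coe_nonneg _
  have hpow : t⁻¹ ^ ((i : ℕ) - (l1 : ℕ) + ((l : ℕ) - (j : ℕ))) ≤ t⁻¹ ^ n :=
    pow_le_pow_right₀ hti (by have := i.2; simp [hl1def]; omega)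
  calc ((a i : ℝ≥0) : ℝ) ≤ t⁻¹ ^ ((i : ℕ) - (l1 : ℕ)) * ((a l1 : ℝ≥0) : ℝ) := h1
    _ ≤ t⁻¹ ^ ((i : ℕ) - (l1 : ℕ)) * (M⁻¹ * (t⁻¹ ^ ((l : ℕ) - (j : ℕ)) * ((a j : ℝ≥0) : ℝ))) :=
        mul_le_mul_of_nonneg_left (h2.trans (mul_le_mul_of_nonneg_left h3 (inv_nonneg.2 hM.le)))
          (pow_nonneg (inv_nonneg.2 ht.le) _)
    _ = M⁻¹ * t⁻¹ ^ ((i : ℕ) - (l1 : ℕ) + ((l : ℕ) - (j : ℕ))) * ((a j : ℝ≥0) : ℝ) := by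
        rw [pow_add]; ring
    _ ≤ M⁻¹ * (t⁻¹ ^ n) * ((a j : ℝ≥0) : ℝ) :=
        mul_le_mul_of_nonneg_right (mul_le_mul_of_nonneg_left hpow (inv_nonneg.2 hM.le)) haj

/-- Going down the cone: `a_i ≤ (t⁻¹)ⁿ a_j` for `j ≤ i` (`0 < t ≤ 1`). [folklore] -/
theorem apply_le_inv_pow_mul_of_le {t : ℝ} (ht : 0 < t) (ht1 : t ≤ 1) {a : Fin n → ℝ≥0ˣ}
    (hroot : ∀ i j : Fin n, (j : ℕ) = (i : ℕ) + 1 → t * ((a j : ℝ≥0) : ℝ) ≤ ((a i : ℝ≥0) : ℝ))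
    {i j : Fin n} (hji : (j : ℕ) ≤ (i : ℕ)) :
    ((a i : ℝ≥0) : ℝ) ≤ t⁻¹ ^ n * ((a j : ℝ≥0) : ℝ) := by
  have hti : 1 ≤ t⁻¹ := one_le_inv_iff₀.2 ⟨ht, ht1⟩
  refine (siegelRoot_apply_le_inv_pow_mul ht hroot (Fin.le_def.2 hji)).trans ?_
  exact mul_le_mul_of_nonneg_right (pow_le_pow_right₀ hti (by have := i.2; omega))
    (NNReal.coe_nonneg _)

/-- **Quotient bound inside a block**: on the cone (`0 < t ≤ 1`), if `i` and `j` carry the same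
label for the threshold `M ≥ 1`, then `a_i ≤ (max M t⁻¹)ⁿ a_j`. [folklore] -/
theorem apply_le_of_gapLabel_eq {t M : ℝ} (ht : 0 < t) (ht1 : t ≤ 1) (hM : 1 ≤ M)
    {a : Fin n → ℝ≥0ˣ}
    (hroot : ∀ i j : Fin n, (j : ℕ) = (i : ℕ) + 1 → t * ((a j : ℝ≥0) : ℝ) ≤ ((a i : ℝ≥0) : ℝ))
    {i j : Fin n} (h : gapLabel a M i = gapLabel a M j) :
    ((a i : ℝ≥0) : ℝ) ≤ (max M t⁻¹) ^ n * ((a j : ℝ≥0) : ℝ) := by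
  have haj : 0 ≤ ((a j : ℝ≥0) : ℝ) := NNReal.coe_nonneg _
  have h1M : (1 : ℝ) ≤ max M t⁻¹ := hM.trans (le_max_left _ _)
  rcases le_total (i : ℕ) (j : ℕ) with hij | hji
  · -- up, inside the block: `a_i ≤ M^{j-i} a_j`
    have hb := apply_le_pow_mul_of_forall_not_largeGap (zero_le_one.trans hM) a hij
      (fun l h1 h2 => not_largeGap_of_gapLabel_eq a M h h1 h2)
    refine hb.trans (mul_le_mul_of_nonneg_right ?_ haj)
    calc M ^ ((j : ℕ) - (i : ℕ)) ≤ (max M t⁻¹) ^ ((j : ℕ) - (i : ℕ)) :=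
          pow_le_pow_left₀ (zero_le_one.trans hM) (le_max_left _ _) _
      _ ≤ (max M t⁻¹) ^ n := pow_le_pow_right₀ h1M (by have := j.2; omega)
  · -- down: the cone
    refine (apply_le_inv_pow_mul_of_le ht ht1 hroot hji).trans (mul_le_mul_of_nonneg_right ?_ haj)
    exact pow_le_pow_left₀ (inv_nonneg.2 ht.le) (le_max_right _ _) _

/-- **Contraction across blocks**: on the cone (`0 < t ≤ 1`), with threshold
`M ≥ ε⁻¹ (t⁻¹)ⁿ > 0`, indices with different labels `gapLabel j < gapLabel i` satisfy
`a_i / a_j ≤ ε`. [folklore] -/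
theorem div_le_of_gapLabel_lt {t M ε : ℝ} (ht : 0 < t) (ht1 : t ≤ 1) (hε : 0 < ε)
    (hM : ε⁻¹ * t⁻¹ ^ n ≤ M) {a : Fin n → ℝ≥0ˣ}
    (hroot : ∀ i j : Fin n, (j : ℕ) = (i : ℕ) + 1 → t * ((a j : ℝ≥0) : ℝ) ≤ ((a i : ℝ≥0) : ℝ))
    {i j : Fin n} (h : gapLabel a M j < gapLabel a M i) :
    ((a i : ℝ≥0) : ℝ) / ((a j : ℝ≥0) : ℝ) ≤ ε := by
  have htn : 0 < t⁻¹ ^ n := pow_pos (inv_pos.2 ht) n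
  have hM0 : 0 < M := lt_of_lt_of_le (mul_pos (inv_pos.2 hε) htn) hM
  obtain ⟨l, hjl, hli, hl⟩ := exists_largeGap_of_gapLabel_lt a M h
  have hb := apply_le_of_largeGap ht ht1 hM0 hroot hjl hli hl
  have haj : 0 < ((a j : ℝ≥0) : ℝ) := NNReal.coe_pos.2 (pos_iff_ne_zero.2 (a j).ne_zero)
  rw [div_le_iff₀ haj]
  refine hb.trans (mul_le_mul_of_nonneg_right ?_ haj.le)
  -- `M⁻¹ (t⁻¹)ⁿ ≤ ε`
  rw [inv_mul_le_iff₀ hM0]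
  calc t⁻¹ ^ n = ε * (ε⁻¹ * t⁻¹ ^ n) := by field_simp
    _ ≤ ε * M := mul_le_mul_of_nonneg_left hM hε.le
    _ = M * ε := mul_comm _ _

end Gaps

/-! ### Block-diagonal parts and the unipotent radical -/

section Levi

variable {n : ℕ} {R S : Type*} [CommRing R] [CommRing S] {α : Type*} [LinearOrder α]
  [Fintype α] (c : Fin n → α)

/-- **Entries of the block-diagonal part**: the `(i, j)` entry of
`leviEmbedding (leviProjection p)` (the block-diagonal matrix with the diagonal blocks of `p`) is
`p_{ij}` if `i, j` lie in the same block and `0` otherwise. [folklore] -/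
theorem coe_leviEmbedding_leviProjection_apply (p : standardParabolicGL R c) (i j : Fin n) :
    ((leviEmbedding R c (leviProjection R c p) : GL (Fin n) R) : Matrix (Fin n) (Fin n) R) i j =
      if c i = c j then ((p : GL (Fin n) R) : Matrix (Fin n) (Fin n) R) i j else 0 := by
  rw [leviEmbedding_apply, blockDiagonalGL_apply_coe]
  by_cases h : c i = c j
  · rw [if_pos h]
    have hj : (⟨c j, ⟨j, rfl⟩⟩ : Σ a, {k // c k = a}) = ⟨c i, ⟨j, h.symm⟩⟩ :=
      Sigma.subtype_ext h.symm rfl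
    rw [hj, Matrix.blockDiagonal'_apply_eq]
    rfl
  · rw [if_neg h, Matrix.blockDiagonal'_apply_ne _ _ _ h]

omit [Fintype α] in
/-- Two elements of `P_c` with the same block-diagonal part differ by an element of the unipotent
radical: `p * q⁻¹ ∈ U_c`. [folklore] -/
theorem mul_inv_mem_unipotentRadicalGL_of_leviProjection_eq {p q : standardParabolicGL R c}
    (h : leviProjection R c p = leviProjection R c q) :
    (p : GL (Fin n) R) * (q : GL (Fin n) R)⁻¹ ∈ unipotentRadicalGL R c := by
  refine ⟨p * q⁻¹, (MonoidHom.mem_ker).2 ?_, by simp⟩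
  rw [map_mul, map_inv, h, mul_inv_cancel]

omit [Fintype α] in
/-- For a monotone labelling the unipotent radical `U_c` consists of upper unitriangular
matrices. [folklore] -/
theorem unipotentRadicalGL_le_upperUnitriangular (hc : Monotone c) :
    unipotentRadicalGL R c ≤ upperUnitriangular (Fin n) R := by
  intro g hg
  rw [mem_unipotentRadicalGL_iff] at hg
  obtain ⟨hbt, hdiag⟩ := hg
  rw [mem_upperUnitriangular_iff]
  have hentry : ∀ i j : Fin n, c i = c j →
      (g : Matrix (Fin n) (Fin n) R) i j = (1 : Matrix (Fin n) (Fin n) R) i j := by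
    intro i j hij
    have h1 := hdiag (c i)
    have h2 := congrFun (congrFun h1 ⟨i, rfl⟩) ⟨j, hij.symm⟩
    rw [Matrix.toSquareBlock_def, Matrix.of_apply] at h2
    rw [h2, Matrix.one_apply, Matrix.one_apply]
    by_cases hij' : i = j
    · subst hij'; simp
    · rw [if_neg hij', if_neg (fun h => hij' (Subtype.ext_iff.1 h))]
  refine ⟨fun i j hji => ?_, fun i => by rw [hentry i i rfl, Matrix.one_apply_eq]⟩
  -- below the diagonal: either across blocks (block triangular) or inside a block (identity)
  change (j : Fin n) < i at hji
  rcases lt_or_eq_of_le (hc hji.le) with hlt | heq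
  · exact hbt hlt
  · rw [hentry i j heq.symm, Matrix.one_apply_ne (ne_of_gt hji)]

/-- `GeneralLinearGroup.map` of an injective ring map is injective (a private copy of
`generalLinearGroup_map_injective` of `IwahoriGL`, which is not imported here). [folklore] -/
private theorem glMap_injective {f : R →+* S} (hf : Function.Injective f) :
    Function.Injective (Matrix.GeneralLinearGroup.map (n := Fin n) f) := by
  intro g h hgh
  refine Matrix.GeneralLinearGroup.ext fun i j => hf ?_
  have := congrArg (fun x : GL (Fin n) S => (x : Matrix (Fin n) (Fin n) S) i j) hgh
  simpa [Matrix.GeneralLinearGroup.map_apply] using this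

/-- `GeneralLinearGroup.map` preserves upper unitriangular matrices. [folklore] -/
theorem map_mem_upperUnitriangular (f : R →+* S) {u : GL (Fin n) R}
    (hu : u ∈ upperUnitriangular (Fin n) R) :
    Matrix.GeneralLinearGroup.map f u ∈ upperUnitriangular (Fin n) S := by
  rw [mem_upperUnitriangular_iff] at hu ⊢
  refine ⟨fun i j hji => ?_, fun i => ?_⟩
  · rw [Matrix.GeneralLinearGroup.map_apply]
    change f ((u : Matrix (Fin n) (Fin n) R) i j) = 0
    rw [hu.1 hji, map_zero]
  · rw [Matrix.GeneralLinearGroup.map_apply]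
    change f ((u : Matrix (Fin n) (Fin n) R) i i) = 1
    rw [hu.2 i, map_one]

end Levi

/-! ### The multiplicity bound -/

section Multiplicity

variable {n : ℕ} {K : Type} [Field K] [NumberField K]

/-- The scaling map of a labelling `c`: `Φ_c(r, X)_{ij} = (r_{ij}, 1) · X_{ij}` on the blocks of
`c` and `0` off them; continuous. [folklore] -/
def leviBlockScale {α : Type*} (c : Fin n → α)
    (p : (Fin n → Fin n → ℝ) × Matrix (Fin n) (Fin n) (AdeleRing (𝓞 K) K)) :
    Matrix (Fin n) (Fin n) (AdeleRing (𝓞 K) K) :=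
  Matrix.of fun i j => if c i = c j then realAdele K (p.1 i j) * p.2 i j else 0

/-- The scaling map `Φ_c` is continuous (entrywise products of continuous functions). [folklore] -/
theorem continuous_leviBlockScale {α : Type*} (c : Fin n → α) :
    Continuous (leviBlockScale (K := K) c) := by
  refine continuous_pi fun i => continuous_pi fun j => ?_
  have e : (fun p : (Fin n → Fin n → ℝ) × Matrix (Fin n) (Fin n) (AdeleRing (𝓞 K) K) =>
      leviBlockScale (K := K) c p i j) = fun p =>
        if c i = c j then realAdele K (p.1 i j) * p.2 i j else 0 := by
    funext p; rfl
  rw [e]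
  by_cases hij : c i = c j
  · simp only [if_pos hij]
    have h1 : Continuous fun p : (Fin n → Fin n → ℝ) ×
        Matrix (Fin n) (Fin n) (AdeleRing (𝓞 K) K) => p.1 i j :=
      (continuous_apply j).comp ((continuous_apply i).comp continuous_fst)
    have h2 : Continuous fun p : (Fin n → Fin n → ℝ) ×
        Matrix (Fin n) (Fin n) (AdeleRing (𝓞 K) K) => p.2 i j :=
      (continuous_apply j).comp ((continuous_apply i).comp continuous_snd)
    exact ((continuous_realAdele K).comp h1).mul h2
  · simp only [if_neg hij]
    exact continuous_const

/-- **The block-diagonal part of a rational point of `s Ω s⁻¹`**: if `γ ∈ P_c(K)` has diagonal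
image `s ω s⁻¹`, `s = diag(a)`, then the diagonal image of its block-diagonal part is
`Φ_c(r, ω)` with `r_{ij} = a_i / a_j` on the blocks. [folklore] -/
theorem coe_map_leviEmbedding_leviProjection_eq_blockScale {α : Type*} [LinearOrder α]
    [Fintype α] (c : Fin n → α) (a : Fin n → ℝ≥0ˣ) {γ : GL (Fin n) K}
    (hγ : γ ∈ standardParabolicGL K c)
    {ω : GL (Fin n) (AdeleRing (𝓞 K) K)}
    (h : Matrix.GeneralLinearGroup.map (algebraMap K (AdeleRing (𝓞 K) K)) γ =
      posRealDiagonal n K a * ω * (posRealDiagonal n K a)⁻¹) :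
    ((Matrix.GeneralLinearGroup.map (algebraMap K (AdeleRing (𝓞 K) K))
        (leviEmbedding K c (leviProjection K c ⟨γ, hγ⟩)) : GL (Fin n) (AdeleRing (𝓞 K) K)) :
          Matrix (Fin n) (Fin n) (AdeleRing (𝓞 K) K)) =
      leviBlockScale c (fun i j => if c i = c j then ((a i : ℝ≥0) : ℝ) / ((a j : ℝ≥0) : ℝ) else 0,
        (ω : Matrix (Fin n) (Fin n) (AdeleRing (𝓞 K) K))) := by
  ext i j
  rw [Matrix.GeneralLinearGroup.map_apply]
  change algebraMap K (AdeleRing (𝓞 K) K)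
    (((leviEmbedding K c (leviProjection K c ⟨γ, hγ⟩) : GL (Fin n) K) : Matrix (Fin n) (Fin n) K)
      i j) = _
  rw [coe_leviEmbedding_leviProjection_apply]
  simp only [leviBlockScale, Matrix.of_apply]
  by_cases hij : c i = c j
  · rw [if_pos hij, if_pos hij, if_pos hij]
    have he : algebraMap K (AdeleRing (𝓞 K) K) ((γ : Matrix (Fin n) (Fin n) K) i j) =
        ((Matrix.GeneralLinearGroup.map (algebraMap K (AdeleRing (𝓞 K) K)) γ :
          GL (Fin n) (AdeleRing (𝓞 K) K)) : Matrix (Fin n) (Fin n) (AdeleRing (𝓞 K) K)) i j := by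
      rw [Matrix.GeneralLinearGroup.map_apply]
    change algebraMap K (AdeleRing (𝓞 K) K) ((γ : Matrix (Fin n) (Fin n) K) i j) = _
    rw [he, h, coe_posRealDiagonal_mul_mul_inv_apply]
  · rw [if_neg hij, if_neg hij, map_zero]

/-- **Bounded multiplicity modulo rational unipotents** (the group-theoretic core of the bound
`∫_{N(K)\N(K) s Ω} |φ| ≪ ‖φ‖` in Garrett (2018), end of proof of Thm. 7.3.10, and Getz–Hahn
(2024), (9.23); Godement's proof of Borel's Siegel property, Sém. Bourbaki 257, §10, Lemmes 1–3,
made effective for `GL_n`). For every compact `Ω ⊆ GL_n(𝔸_K)` and `t > 0` there is `m₀ ∈ ℕ` such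
that for every `a` in the Siegel cone (`t · a_{l+1} ≤ a_l` for all `l`), writing `s = diag(a)`
(`posRealDiagonal n K a`), there is a finite set `F ⊆ GL_n(K)` of at most `m₀` rational points with
`GL_n(K) ∩ s Ω s⁻¹ ⊆ (GL_n(K) ∩ N(𝔸_K)) · F`, `N` the upper unitriangular group: the rational
points of `s Ω s⁻¹` lie in at most `m₀` right cosets of the rational unipotent group, uniformly in
the position `s` on the cone. [cite: Godement1964, §10, Lemmes 1–3 (proof of Théorème 9)] -/
theorem exists_forall_siegelCone_subset_unipotent_mul
    {Ω : Set (GL (Fin n) (AdeleRing (𝓞 K) K))} (hΩ : IsCompact Ω) {t : ℝ} (ht : 0 < t) :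
    ∃ m₀ : ℕ, ∀ a : Fin n → ℝ≥0ˣ,
      (∀ i j : Fin n, (j : ℕ) = (i : ℕ) + 1 → t * ((a j : ℝ≥0) : ℝ) ≤ ((a i : ℝ≥0) : ℝ)) →
      ∃ F : Set (GL (Fin n) (AdeleRing (𝓞 K) K)), F.Finite ∧ F.ncard ≤ m₀ ∧
        F ⊆ (rationalPointsGL n K : Set (GL (Fin n) (AdeleRing (𝓞 K) K))) ∧
        (rationalPointsGL n K : Set (GL (Fin n) (AdeleRing (𝓞 K) K))) ∩
            (fun ω => posRealDiagonal n K a * ω * (posRealDiagonal n K a)⁻¹) '' Ω ⊆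
          ((rationalPointsGL n K ⊓ upperUnitriangular (Fin n) (AdeleRing (𝓞 K) K) :
              Subgroup (GL (Fin n) (AdeleRing (𝓞 K) K))) :
            Set (GL (Fin n) (AdeleRing (𝓞 K) K))) * F := by
  haveI : T2Space (GL (Fin n) (AdeleRing (𝓞 K) K)) := t2Space_gl n K
  haveI : T2Space (AdeleRing (𝓞 K) K) := by
    haveI : T2Space (FiniteAdeleRing (𝓞 K) K) := inferInstanceAs <| T2Space
      (RestrictedProduct (fun w : HeightOneSpectrum (𝓞 K) => w.adicCompletion K)
        (fun w => (w.adicCompletionIntegers K : Set (w.adicCompletion K))) Filter.cofinite)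
    haveI : T2Space (InfiniteAdeleRing K) :=
      inferInstanceAs <| T2Space ((w : InfinitePlace K) → w.Completion)
    exact inferInstanceAs <| T2Space (InfiniteAdeleRing K × FiniteAdeleRing (𝓞 K) K)
  -- the symmetric compact set and the contraction constant
  set Ω' : Set (GL (Fin n) (AdeleRing (𝓞 K) K)) := Ω ∪ Ω⁻¹ with hΩ'
  have hΩ'c : IsCompact Ω' := hΩ.union hΩ.inv
  have hΩ'inv : ∀ ω ∈ Ω', ω⁻¹ ∈ Ω' := by
    rintro ω (h | h)
    · exact Or.inr (Set.inv_mem_inv.2 h)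
    · exact Or.inl (Set.mem_inv.1 h)
  obtain ⟨ε, hε, hPL⟩ := exists_pos_forall_mem_standardParabolicGL_of_map_eq_conj (K := K) hΩ'c
  -- thresholds
  set t' : ℝ := min t 1 with ht'
  have ht'0 : 0 < t' := lt_min ht one_pos
  have ht'1 : t' ≤ 1 := min_le_right _ _
  set M : ℝ := max 1 (ε⁻¹ * t'⁻¹ ^ n) with hM
  have hM1 : 1 ≤ M := le_max_left _ _
  have hMε : ε⁻¹ * t'⁻¹ ^ n ≤ M := le_max_right _ _
  set Rb : ℝ := (max M t'⁻¹) ^ n with hRb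
  have hRb0 : 0 ≤ Rb := pow_nonneg (le_trans zero_le_one (hM1.trans (le_max_left _ _))) _
  -- the box of scalars and the compact sets of matrices
  set B : Set (Fin n → Fin n → ℝ) := Set.pi Set.univ fun _ => Set.pi Set.univ fun _ => Icc 0 Rb
    with hB
  have hBc : IsCompact B := isCompact_univ_pi fun _ => isCompact_univ_pi fun _ => isCompact_Icc
  set V : Set (Matrix (Fin n) (Fin n) (AdeleRing (𝓞 K) K)) := Units.val '' Ω' with hV
  have hVc : IsCompact V := hΩ'c.image Units.continuous_val
  -- for each labelling, a compact set of units containing all relevant block-diagonal parts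
  have hT : ∀ c : Fin n → Fin (n + 1), ∃ T : Set (GL (Fin n) (AdeleRing (𝓞 K) K)), IsCompact T ∧
      {g : GL (Fin n) (AdeleRing (𝓞 K) K) |
        (g : Matrix (Fin n) (Fin n) (AdeleRing (𝓞 K) K)) ∈ leviBlockScale c '' (B ×ˢ V) ∧
        ((g⁻¹ : GL (Fin n) (AdeleRing (𝓞 K) K)) : Matrix (Fin n) (Fin n) (AdeleRing (𝓞 K) K)) ∈
          leviBlockScale c '' (B ×ˢ V)} ⊆ T := fun c =>
    Units.exists_isCompact_superset_of_val_of_inv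
      ((hBc.prod hVc).image (continuous_leviBlockScale c))
      ((hBc.prod hVc).image (continuous_leviBlockScale c)) (fun g hg => hg.1) (fun g hg => hg.2)
  choose T hTc hTsub using hT
  set Tall : Set (GL (Fin n) (AdeleRing (𝓞 K) K)) := ⋃ c, T c with hTall
  have hTallc : IsCompact Tall := isCompact_iUnion fun c => hTc c
  -- the finite set of rational points in `Tall`
  set Γ : Subgroup (GL (Fin n) (AdeleRing (𝓞 K) K)) := rationalPointsGL n K with hΓ
  have hΓclosed : IsClosed (Γ : Set (GL (Fin n) (AdeleRing (𝓞 K) K))) :=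
    isClosed_arithmeticSubgroup_gl n K
  haveI hΓdisc : DiscreteTopology ↥Γ := gl_isDiscreteRational_holds n K
  set D : Set (GL (Fin n) (AdeleRing (𝓞 K) K)) := (Γ : Set (GL (Fin n) (AdeleRing (𝓞 K) K))) ∩ Tall
    with hD
  have hDdisc : DiscreteTopology ↥D := DiscreteTopology.of_subset hΓdisc inter_subset_left
  have hDfin : D.Finite :=
    (hTallc.inter_left hΓclosed).finite (isDiscrete_iff_discreteTopology.2 hDdisc)
  refine ⟨D.ncard, fun a hroot => ?_⟩
  -- the cone inequalities for `t' ≤ t`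
  have hroot' : ∀ i j : Fin n, (j : ℕ) = (i : ℕ) + 1 →
      t' * ((a j : ℝ≥0) : ℝ) ≤ ((a i : ℝ≥0) : ℝ) := fun i j hij =>
    (mul_le_mul_of_nonneg_right (min_le_left _ _) (NNReal.coe_nonneg _)).trans (hroot i j hij)
  -- the labelling of `a` and its two properties
  set c : Fin n → Fin (n + 1) := gapLabel a M with hc
  have hcmono : Monotone c := monotone_gapLabel a M
  have hcontr : ∀ i j : Fin n, c j < c i → ((a i : ℝ≥0) : ℝ) / ((a j : ℝ≥0) : ℝ) ≤ ε :=
    fun i j hij => div_le_of_gapLabel_lt ht'0 ht'1 hε hMε hroot' hij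
  have hblock : ∀ i j : Fin n, c i = c j →
      ((a i : ℝ≥0) : ℝ) / ((a j : ℝ≥0) : ℝ) ≤ Rb := by
    intro i j hij
    have haj : 0 < ((a j : ℝ≥0) : ℝ) := NNReal.coe_pos.2 (pos_iff_ne_zero.2 (a j).ne_zero)
    rw [div_le_iff₀ haj]
    exact apply_le_of_gapLabel_eq ht'0 ht'1 hM1 hroot' hij
  set s : GL (Fin n) (AdeleRing (𝓞 K) K) := posRealDiagonal n K a with hs
  set X : Set (GL (Fin n) (AdeleRing (𝓞 K) K)) := (fun ω => s * ω * s⁻¹) '' Ω with hX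
  -- the scalar matrix of `a` lies in the box
  set r : Fin n → Fin n → ℝ := fun i j =>
    if c i = c j then ((a i : ℝ≥0) : ℝ) / ((a j : ℝ≥0) : ℝ) else 0 with hr
  have hrB : r ∈ B := by
    simp only [hB, Set.mem_pi, Set.mem_univ, forall_true_left, Set.mem_Icc]
    intro i j
    by_cases hij : c i = c j
    · simp only [hr, if_pos hij]
      exact ⟨by positivity, hblock i j hij⟩
    · simp only [hr, if_neg hij]
      exact ⟨le_rfl, hRb0⟩
  -- Step 1: rational points of `X` come from `P_c(K)`, and their block-diagonal parts lie in `D`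
  have hrat : ∀ g ∈ (Γ : Set (GL (Fin n) (AdeleRing (𝓞 K) K))) ∩ X,
      ∃ (γ : GL (Fin n) K) (hγ : γ ∈ standardParabolicGL K c),
        Matrix.GeneralLinearGroup.map (algebraMap K (AdeleRing (𝓞 K) K)) γ = g ∧
        Matrix.GeneralLinearGroup.map (algebraMap K (AdeleRing (𝓞 K) K))
          (leviEmbedding K c (leviProjection K c ⟨γ, hγ⟩)) ∈ D := by
    rintro g ⟨⟨γ, rfl⟩, ω, hω, hgω⟩
    have hω' : ω ∈ Ω' := Or.inl hω
    have hγP : γ ∈ standardParabolicGL K c :=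
      hPL c a (fun i j hij => hcontr i j hij) γ ω hω' hgω.symm
    refine ⟨γ, hγP, rfl, ⟨_, rfl⟩, Set.mem_iUnion.2 ⟨c, hTsub c ⟨?_, ?_⟩⟩⟩
    · -- the matrix of the block-diagonal part
      rw [coe_map_leviEmbedding_leviProjection_eq_blockScale c a hγP hgω.symm]
      exact ⟨(r, (ω : Matrix (Fin n) (Fin n) (AdeleRing (𝓞 K) K))),
        Set.mk_mem_prod hrB (Set.mem_image_of_mem _ hω'), rfl⟩
    · -- its inverse: the block-diagonal part of `γ⁻¹ = s ω⁻¹ s⁻¹`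
      have hinv : γ⁻¹ ∈ standardParabolicGL K c := Subgroup.inv_mem _ hγP
      have hγinv : Matrix.GeneralLinearGroup.map (algebraMap K (AdeleRing (𝓞 K) K)) γ⁻¹ =
          posRealDiagonal n K a * ω⁻¹ * (posRealDiagonal n K a)⁻¹ := by
        rw [map_inv, ← hgω]
        simp only [mul_inv_rev, inv_inv, mul_assoc, hs]
      have heq : (Matrix.GeneralLinearGroup.map (algebraMap K (AdeleRing (𝓞 K) K))
          (leviEmbedding K c (leviProjection K c ⟨γ, hγP⟩)))⁻¹ =
          Matrix.GeneralLinearGroup.map (algebraMap K (AdeleRing (𝓞 K) K))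
            (leviEmbedding K c (leviProjection K c ⟨γ⁻¹, hinv⟩)) := by
        rw [← map_inv, ← map_inv, ← map_inv]
        rfl
      rw [heq, coe_map_leviEmbedding_leviProjection_eq_blockScale c a hinv hγinv]
      exact ⟨(r, ((ω⁻¹ : GL (Fin n) (AdeleRing (𝓞 K) K)) :
          Matrix (Fin n) (Fin n) (AdeleRing (𝓞 K) K))),
        Set.mk_mem_prod hrB (Set.mem_image_of_mem _ (hΩ'inv ω hω')), rfl⟩
  -- the block-diagonal representative map on `Γ ∩ X`
  have hΛ : ∀ g : GL (Fin n) (AdeleRing (𝓞 K) K), ∃ m : GL (Fin n) (AdeleRing (𝓞 K) K),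
      g ∈ (Γ : Set (GL (Fin n) (AdeleRing (𝓞 K) K))) ∩ X →
        ∃ (γ : GL (Fin n) K) (hγ : γ ∈ standardParabolicGL K c),
          Matrix.GeneralLinearGroup.map (algebraMap K (AdeleRing (𝓞 K) K)) γ = g ∧
          Matrix.GeneralLinearGroup.map (algebraMap K (AdeleRing (𝓞 K) K))
            (leviEmbedding K c (leviProjection K c ⟨γ, hγ⟩)) = m ∧ m ∈ D := by
    intro g
    by_cases hg : g ∈ (Γ : Set (GL (Fin n) (AdeleRing (𝓞 K) K))) ∩ X
    · obtain ⟨γ, hγ, hγg, hD'⟩ := hrat g hg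
      exact ⟨_, fun _ => ⟨γ, hγ, hγg, rfl, hD'⟩⟩
    · exact ⟨1, fun h => absurd h hg⟩
  choose Λ hΛ using hΛ
  -- Step 2: equal block-diagonal parts ⇒ same coset of the rational unipotent group
  have hker : ∀ g ∈ (Γ : Set (GL (Fin n) (AdeleRing (𝓞 K) K))) ∩ X,
      ∀ g' ∈ (Γ : Set (GL (Fin n) (AdeleRing (𝓞 K) K))) ∩ X, Λ g = Λ g' →
        g * g'⁻¹ ∈ (Γ ⊓ upperUnitriangular (Fin n) (AdeleRing (𝓞 K) K) :
          Subgroup (GL (Fin n) (AdeleRing (𝓞 K) K))) := by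
    intro g hg g' hg' hgg'
    obtain ⟨γ, hγ, hγg, hγm, -⟩ := hΛ g hg
    obtain ⟨γ', hγ', hγ'g, hγ'm, -⟩ := hΛ g' hg'
    have hinj := glMap_injective (n := n)
      (NumberField.AdeleRing.algebraMap_injective (R := 𝓞 K) (K := K))
    have hlevi : leviEmbedding K c (leviProjection K c ⟨γ, hγ⟩) =
        leviEmbedding K c (leviProjection K c ⟨γ', hγ'⟩) :=
      hinj (hγm.trans (hgg'.trans hγ'm.symm))
    have hproj : leviProjection K c ⟨γ, hγ⟩ = leviProjection K c ⟨γ', hγ'⟩ := by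
      have h1 := congrArg (leviProjection K c) (Subtype.ext hlevi :
        leviEmbeddingP K c (leviProjection K c ⟨γ, hγ⟩) =
          leviEmbeddingP K c (leviProjection K c ⟨γ', hγ'⟩))
      rwa [leviProjection_leviEmbeddingP_apply, leviProjection_leviEmbeddingP_apply] at h1
    have hu : γ * γ'⁻¹ ∈ upperUnitriangular (Fin n) K :=
      unipotentRadicalGL_le_upperUnitriangular c hcmono
        (mul_inv_mem_unipotentRadicalGL_of_leviProjection_eq c hproj)
    rw [← hγg, ← hγ'g, ← map_inv, ← map_mul]
    exact ⟨⟨γ * γ'⁻¹, rfl⟩, map_mem_upperUnitriangular _ hu⟩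
  -- Step 3: the finite set of representatives
  set Mset : Set (GL (Fin n) (AdeleRing (𝓞 K) K)) :=
    Λ '' ((Γ : Set (GL (Fin n) (AdeleRing (𝓞 K) K))) ∩ X) with hMset
  have hMD : Mset ⊆ D := by
    rintro _ ⟨g, hg, rfl⟩
    obtain ⟨-, -, -, -, hD'⟩ := hΛ g hg
    exact hD'
  have hMfin : Mset.Finite := hDfin.subset hMD
  -- a preimage for each value
  have hrep : ∀ m : GL (Fin n) (AdeleRing (𝓞 K) K), ∃ g : GL (Fin n) (AdeleRing (𝓞 K) K),
      m ∈ Mset → g ∈ (Γ : Set (GL (Fin n) (AdeleRing (𝓞 K) K))) ∩ X ∧ Λ g = m := by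
    intro m
    by_cases hm : m ∈ Mset
    · obtain ⟨g, hg, hgm⟩ := hm
      exact ⟨g, fun _ => ⟨hg, hgm⟩⟩
    · exact ⟨1, fun h => absurd h hm⟩
  choose rep hrep using hrep
  set F : Set (GL (Fin n) (AdeleRing (𝓞 K) K)) := rep '' Mset with hF
  refine ⟨F, hMfin.image rep, ?_, ?_, ?_⟩
  · -- `#F ≤ #Mset ≤ #D`
    exact (Set.ncard_image_le hMfin).trans (Set.ncard_le_ncard hMD hDfin)
  · -- `F ⊆ Γ`
    rintro _ ⟨m, hm, rfl⟩
    exact (hrep m hm).1.1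
  · -- the covering
    intro g hg
    have hm : Λ g ∈ Mset := Set.mem_image_of_mem _ hg
    obtain ⟨hrep1, hrep2⟩ := hrep (Λ g) hm
    refine ⟨g * (rep (Λ g))⁻¹, hker g hg (rep (Λ g)) hrep1 hrep2.symm, rep (Λ g),
      Set.mem_image_of_mem _ hm, ?_⟩
    simp only [inv_mul_cancel_right]

end Multiplicity

end Literature.NumberTheory.Automorphic
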